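import Literature.NumberTheory.NumberFields.CubicFieldExplicit
import Mathlib.NumberTheory.NumberField.Basic
import Mathlib.FieldTheory.Normal.Defs
import Mathlib.RingTheory.IntegralClosure.IsIntegralClosure.Basic
import HarnessLib

/-!
# The cubic field of a monic integer cubic: degree, discriminant, integral roots in a normal field

Route `ResidualThetaTransportAtTwo`, crux K0⁺ `HeckeThetaPartnerAdicAtTwo` (stmt-BirchSwinnertonDyer-20690),
helper §C2 of the line "proof from print".  THEOREMS ONLY (no definition, no named fact, no `sorry`).

For an irreducible monic integer cubic `h = X³ + aX² + bX + c` (the tree's `MonicCubic.poly a b c`,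
`MonicCubic.polyQ` over `ℚ`) and the cubic field `K_h = ℚ[X]/(h)` (Mathlib `AdjoinRoot`):
* `aeval_root_poly`, `finrank_adjoinRoot_polyQ` — `K_h = ℚ(θ)`, `h(θ) = 0`, `[K_h : ℚ] = 3`;
* `exists_disc_eq_sq_mul_discr` — `disc(h) = i² · d_{K_h}` for a nonzero integer `i` (the index
  `[𝓞 : ℤ[θ]]`; tree theorem `discr_powerBasis_eq_indexDet_sq_mul_discr` and `MonicCubic.discr_pb`);
* `exists_eq_mul_sq_of_squarefree` — arithmetic: `D i² = d n²`, `d` squarefree, `i ≠ 0` ⟹ `D = d f²`;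
* `card_roots_ringOfIntegers_eq_three` — in a number field `L` normal over `ℚ` receiving `K_h`, `h` has
  three roots in `𝓞 L`;
* `eq_of_sub_mem_of_disc_not_mem` — if `disc(h) ∉ Q` for a prime `Q` of `𝓞 L`, these roots are pairwise
  incongruent modulo `Q` (`disc(h) = ∏ (θᵢ − θⱼ)²`, `Cubic.disc_eq_prod_three_roots`).
-/

set_option autoImplicit false
set_option linter.dupNamespace false

noncomputable section

open Polynomial Module NumberField
open Literature.NumberTheory.NumberFields

namespace Summit.BirchSwinnertonDyer.BirchSwinnertonDyer.Theorems.HeckeThetaPartner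

section Cubic

variable (a b c : ℤ) [hirr : Fact (Irreducible (MonicCubic.polyQ a b c))]

/-- `h(θ) = 0` for the tautological root `θ` of `K_h = ℚ[X]/(h)`. [folklore] -/
theorem aeval_root_poly : aeval (AdjoinRoot.root (MonicCubic.polyQ a b c)) (MonicCubic.poly a b c) = 0 := by
  have h := AdjoinRoot.aeval_eq (f := MonicCubic.polyQ a b c) (MonicCubic.polyQ a b c)
  rw [AdjoinRoot.mk_self] at h
  rw [MonicCubic.polyQ, aeval_map_algebraMap] at h
  exact h

/-- `[K_h : ℚ] = 3`. [folklore] -/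
theorem finrank_adjoinRoot_polyQ : finrank ℚ (AdjoinRoot (MonicCubic.polyQ a b c)) = 3 := by
  have hf : MonicCubic.polyQ a b c ≠ 0 := (MonicCubic.monic_polyQ a b c).ne_zero
  rw [(AdjoinRoot.powerBasis hf).finrank, AdjoinRoot.powerBasis_dim, MonicCubic.natDegree_polyQ]

/-- **`disc(h) = i² · d_{K_h}`** with `i ≠ 0` the index of `ℤ[θ]` in `𝓞_{K_h}`. [cite: Marcus2018, Ch. 2, Exercise 27] -/
theorem exists_disc_eq_sq_mul_discr :
    ∃ i : ℤ, i ≠ 0 ∧ MonicCubic.disc a b c = i ^ 2 * discr (AdjoinRoot (MonicCubic.polyQ a b c)) := by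
  set K := AdjoinRoot (MonicCubic.polyQ a b c)
  have hθ := aeval_root_poly a b c
  have h3 := finrank_adjoinRoot_polyQ a b c
  have hint := MonicCubic.isIntegral_pb_gen hirr.out hθ h3
  refine ⟨indexDet _ hint, indexDet_ne_zero _ hint, ?_⟩
  have h1 := discr_powerBasis_eq_indexDet_sq_mul_discr (MonicCubic.pb hirr.out hθ h3) hint
  rw [MonicCubic.discr_pb hirr.out hθ h3] at h1
  exact_mod_cast h1

end Cubic

/-- **`D i² = d n²` with `d` squarefree and `i ≠ 0` forces `D = d f²`** (and `f ≠ 0` if `D ≠ 0`):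
cancel `g = gcd(i, n)`, then `i'² ∣ d n'²` with `(i', n') = 1` gives `i'² ∣ d`, so `i' = ±1`. [folklore] -/
theorem exists_eq_mul_sq_of_squarefree {D d i n : ℤ} (hd : Squarefree d) (hi : i ≠ 0)
    (h : D * i ^ 2 = d * n ^ 2) : ∃ f : ℤ, D = d * f ^ 2 := by
  obtain ⟨i', n', hi', hn', hcop⟩ : ∃ i' n' : ℤ, i = (Int.gcd i n : ℤ) * i' ∧ n = (Int.gcd i n : ℤ) * n' ∧
      IsCoprime i' n' := by
    obtain ⟨i', hi'⟩ := Int.gcd_dvd_left i n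
    obtain ⟨n', hn'⟩ := Int.gcd_dvd_right i n
    refine ⟨i', n', hi', hn', ?_⟩
    rw [Int.isCoprime_iff_gcd_eq_one]
    have hg0 : Int.gcd i n ≠ 0 := fun h0 => hi (Int.gcd_eq_zero_iff.mp h0).1
    have := Int.gcd_mul_left (Int.gcd i n : ℤ) i' n'
    rw [← hi', ← hn', Int.natAbs_natCast] at this
    have h1 : Int.gcd i n * Int.gcd i' n' = Int.gcd i n * 1 := by rw [mul_one]; exact this.symm
    exact Nat.eq_of_mul_eq_mul_left (Nat.pos_of_ne_zero hg0) h1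
  set g : ℤ := (Int.gcd i n : ℤ) with hg
  have hg0 : g ≠ 0 := by
    rw [hg]; exact_mod_cast fun h0 => hi (Int.gcd_eq_zero_iff.mp h0).1
  have h2 : D * i' ^ 2 = d * n' ^ 2 := by
    have : g ^ 2 * (D * i' ^ 2) = g ^ 2 * (d * n' ^ 2) := by
      rw [hi', hn'] at h; linear_combination h
    exact mul_left_cancel₀ (pow_ne_zero 2 hg0) this
  have hi'0 : i' ≠ 0 := by rintro rfl; rw [mul_zero] at hi'; exact hi hi'
  -- `i'² ∣ d`
  have hdvd : i' ^ 2 ∣ d * n' ^ 2 := ⟨D, by rw [← h2]; ring⟩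
  have hdvd' : i' ^ 2 ∣ d := (IsCoprime.pow (m := 2) (n := 2) hcop).dvd_of_dvd_mul_right hdvd
  have hu : IsUnit i' := hd i' (by rw [← sq]; exact hdvd')
  have hsq : i' ^ 2 = 1 := by
    rcases Int.isUnit_iff.mp hu with h1 | h1 <;> rw [h1] <;> norm_num
  refine ⟨n', ?_⟩
  rw [hsq, mul_one] at h2
  exact h2

section Roots

variable (a b c : ℤ) [hirr : Fact (Irreducible (MonicCubic.polyQ a b c))]
  (L : Type*) [Field L] [NumberField L] [Normal ℚ L] (ι : AdjoinRoot (MonicCubic.polyQ a b c) →ₐ[ℚ] L)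

include ι

/-- The roots of `h` in `L`: `h` splits in the normal field `L ∋ ι(θ)`, with `3` distinct roots. [folklore] -/
theorem card_roots_eq_three_and_nodup :
    ((MonicCubic.poly a b c).map (algebraMap ℤ L)).roots.card = 3 ∧
      ((MonicCubic.poly a b c).map (algebraMap ℤ L)).roots.Nodup := by
  set θ : L := ι (AdjoinRoot.root (MonicCubic.polyQ a b c)) with hθdef
  have hθ : aeval θ (MonicCubic.poly a b c) = 0 := by
    have h0 := aeval_algHom_apply ((ι : AdjoinRoot (MonicCubic.polyQ a b c) →+* L).toIntAlgHom)
      (AdjoinRoot.root (MonicCubic.polyQ a b c)) (MonicCubic.poly a b c)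
    rw [aeval_root_poly, map_zero] at h0
    simpa using h0
  have hmin : minpoly ℚ θ = MonicCubic.polyQ a b c := MonicCubic.minpoly_rat_eq hirr.out hθ
  have hsplit : ((MonicCubic.polyQ a b c).map (algebraMap ℚ L)).Splits := by
    rw [← hmin]; exact Normal.splits inferInstance θ
  have hmap : (MonicCubic.poly a b c).map (algebraMap ℤ L) = (MonicCubic.polyQ a b c).map (algebraMap ℚ L) := by
    rw [MonicCubic.polyQ, Polynomial.map_map, RingHom.ext_int ((algebraMap ℚ L).comp (algebraMap ℤ ℚ)) (algebraMap ℤ L)]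
  refine ⟨?_, ?_⟩
  · rw [hmap, ← hsplit.natDegree_eq_card_roots, natDegree_map, MonicCubic.natDegree_polyQ]
  · rw [hmap]
    exact nodup_roots ((minpoly.irreducible (Algebra.IsIntegral.isIntegral θ)).separable.map |>.of_dvd
      (by rw [hmin]))

/-- **`h` has three roots in `𝓞 L`, and they are distinct** (roots of a monic integer polynomial are
algebraic integers). [folklore] -/
theorem card_roots_ringOfIntegers_eq_three :
    ((MonicCubic.poly a b c).map (Int.castRingHom (𝓞 L))).roots.card = 3 ∧
      ((MonicCubic.poly a b c).map (Int.castRingHom (𝓞 L))).roots.Nodup := by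
  classical
  obtain ⟨hcard, hnodup⟩ := card_roots_eq_three_and_nodup a b c L ι
  set pL := (MonicCubic.poly a b c).map (algebraMap ℤ L) with hpL
  set pO := (MonicCubic.poly a b c).map (Int.castRingHom (𝓞 L)) with hpO
  have hmonO : pO.Monic := (MonicCubic.monic_poly a b c).map _
  have hpO0 : pO ≠ 0 := hmonO.ne_zero
  have hpL0 : pL ≠ 0 := ((MonicCubic.monic_poly a b c).map _).ne_zero
  have hmapO : pO.map (algebraMap (𝓞 L) L) = pL := by
    rw [hpO, hpL, Polynomial.map_map, RingHom.ext_int ((algebraMap (𝓞 L) L).comp (Int.castRingHom (𝓞 L))) (algebraMap ℤ L)]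
  -- every root in `L` is integral
  have hint : ∀ r ∈ pL.roots, IsIntegral ℤ r := by
    intro r hr
    rw [mem_roots hpL0, IsRoot.def, hpL, eval_map, ← aeval_def] at hr
    exact ⟨MonicCubic.poly a b c, MonicCubic.monic_poly a b c, hr⟩
  -- lift the roots to `𝓞 L`
  let lift : ∀ r ∈ pL.roots, 𝓞 L := fun r hr => ⟨r, hint r hr⟩
  set S : Multiset (𝓞 L) := pL.roots.pmap lift (fun _ h => h) with hS
  have hSnodup : S.Nodup := by
    refine Multiset.Nodup.pmap (fun r₁ h₁ r₂ h₂ heq => ?_) hnodup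
    have := congrArg (fun x : 𝓞 L => (x : L)) heq
    exact this
  have hSle : S ≤ pO.roots := by
    rw [Multiset.le_iff_subset hSnodup]
    intro x hx
    obtain ⟨r, hr, rfl⟩ := Multiset.mem_pmap.mp hx
    rw [mem_roots hpO0, IsRoot.def]
    apply (IsFractionRing.injective (𝓞 L) L)
    rw [map_zero, ← eval₂_hom, ← eval_map, hmapO]
    exact (mem_roots hpL0).mp hr
  have hcardS : S.card = 3 := by rw [hS, Multiset.card_pmap, hcard]
  have hle3 : pO.roots.card ≤ 3 := by
    have := card_roots' pO
    rwa [hpO, (MonicCubic.monic_poly a b c).natDegree_map, MonicCubic.natDegree_poly] at this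
  have heq : S = pO.roots := Multiset.eq_of_le_of_card_le hSle (by rw [hcardS]; exact hle3)
  exact ⟨by rw [← heq, hcardS], by rw [← heq]; exact hSnodup⟩

/-- **Roots are incongruent modulo a prime not containing `disc(h)`**: `disc(h) = ∏_{i<j} (θᵢ − θⱼ)²`,
so `θᵢ ≡ θⱼ (mod Q)` for `i ≠ j` would put `disc(h)` in `Q`. [folklore] -/
theorem eq_of_sub_mem_of_disc_not_mem (Q : Ideal (𝓞 L)) [Q.IsPrime]
    (hdisc : ((MonicCubic.disc a b c : ℤ) : 𝓞 L) ∉ Q) :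
    ∀ θ ∈ ((MonicCubic.poly a b c).map (Int.castRingHom (𝓞 L))).roots,
      ∀ θ' ∈ ((MonicCubic.poly a b c).map (Int.castRingHom (𝓞 L))).roots, θ - θ' ∈ Q → θ = θ' := by
  classical
  obtain ⟨hcard, hnodup⟩ := card_roots_ringOfIntegers_eq_three a b c L ι
  set pO := (MonicCubic.poly a b c).map (Int.castRingHom (𝓞 L)) with hpO
  obtain ⟨x, y, z, hxyz⟩ := Multiset.card_eq_three.mp hcard
  -- the discriminant as a product of root differences, in `L`
  have hmonO : pO.Monic := (MonicCubic.monic_poly a b c).map _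
  have hrootsL : (Cubic.map (algebraMap ℚ L) (Cubic.mk 1 (a : ℚ) b c)).roots =
      {(x : L), (y : L), (z : L)} := by
    have h1 : (Cubic.map (algebraMap ℚ L) (Cubic.mk 1 (a : ℚ) b c)).toPoly = pO.map (algebraMap (𝓞 L) L) := by
      rw [Cubic.map_toPoly, hpO, Polynomial.map_map]
      have : (Cubic.mk 1 (a : ℚ) b c).toPoly = MonicCubic.polyQ a b c := by
        rw [MonicCubic.polyQ, MonicCubic.poly_eq_toPoly, ← Cubic.map_toPoly]
        simp [Cubic.map]
      rw [this, MonicCubic.polyQ, Polynomial.map_map,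
        RingHom.ext_int ((algebraMap ℚ L).comp (algebraMap ℤ ℚ)) ((algebraMap (𝓞 L) L).comp (Int.castRingHom (𝓞 L)))]
    have h2 : (pO.map (algebraMap (𝓞 L) L)).roots = pO.roots.map (algebraMap (𝓞 L) L) :=
      (roots_map_of_injective_of_card_eq_natDegree (IsFractionRing.injective (𝓞 L) L)
        (by rw [hcard, hpO, (MonicCubic.monic_poly a b c).natDegree_map, MonicCubic.natDegree_poly])).symm
    rw [Cubic.roots, h1, h2, hxyz]
    simp
  have hdiscQ : (Cubic.mk 1 (a : ℚ) b c).discr = (MonicCubic.disc a b c : ℚ) := by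
    simp only [Cubic.discr, MonicCubic.disc]; push_cast; ring
  have hdiscL := Cubic.discr_eq_prod_three_roots (P := Cubic.mk 1 (a : ℚ) b c) (φ := algebraMap ℚ L)
    one_ne_zero hrootsL
  rw [hdiscQ, map_one] at hdiscL
  have hdiscO : ((MonicCubic.disc a b c : ℤ) : 𝓞 L) = (((x - y) * (x - z) * (y - z)) ^ 2 : 𝓞 L) := by
    apply IsFractionRing.injective (𝓞 L) L
    rw [map_intCast, map_pow, map_mul, map_mul, map_sub, map_sub, map_sub]
    rw [map_intCast] at hdiscL
    rw [hdiscL]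
    ring
  -- case analysis on the two roots
  have hprod_not : (x - y) * (x - z) * (y - z) ∉ Q := by
    intro hmem
    apply hdisc
    rw [hdiscO, sq]
    exact Q.mul_mem_left _ hmem
  have hxy : x - y ∉ Q := fun h => hprod_not (by
    have := Q.mul_mem_right ((x - z) * (y - z)) h
    simpa [mul_assoc] using this)
  have hxz : x - z ∉ Q := fun h => hprod_not (by
    have := Q.mul_mem_right (y - z) (Q.mul_mem_left (x - y) h)
    simpa [mul_assoc, mul_comm, mul_left_comm] using this)
  have hyz : y - z ∉ Q := fun h => hprod_not (Q.mul_mem_left _ h)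
  have hneg : ∀ {u v : 𝓞 L}, u - v ∉ Q → v - u ∉ Q := fun h h' => h (by
    have := Q.neg_mem h'; rwa [neg_sub] at this)
  intro θ hθ θ' hθ' hsub
  rw [hxyz] at hθ hθ'
  simp only [Multiset.insert_eq_cons, Multiset.mem_cons, Multiset.mem_singleton] at hθ hθ'
  rcases hθ with rfl | rfl | rfl <;> rcases hθ' with rfl | rfl | rfl
  all_goals
    first
    | rfl
    | exact absurd hsub hxy
    | exact absurd hsub hxz
    | exact absurd hsub hyz
    | exact absurd hsub (hneg hxy)
    | exact absurd hsub (hneg hxz)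
    | exact absurd hsub (hneg hyz)

end Roots

end Summit.BirchSwinnertonDyer.BirchSwinnertonDyer.Theorems.HeckeThetaPartner

end
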